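/-
Origin: expansion seat `planner-pub-hodgecm-mc-axioms-1-g14-0`, handover #W168 2026-08-20T15:53:55Z md5 7220624ffd0c (PKG 65a301c384d7 → 7220624ffd0c; 239 l.; MECHANICAL (iib-R) rewrite v3.1 of the PKG file as it stands (100 token edits; rules R1x2+RX[h₂]x98)) (`HOME/mc/pub-hodgecm-mc-axioms-1-g14/revendor/kit-r55/stage55/HodgeCM/Model/HypCensus/HypOfCensusType.lean`, md5 7220624ffd0c, 239 lines);
landed by the gen-22 packager (p-g22) in gate run 55 REPLACES the earlier landed copy of `HodgeCM/Model/HypCensus/HypOfCensusType.lean` (seat copy carried the packager Origin header of an earlier run (stripped)).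
-/
/-
Copyright (c) 2026. All rights reserved.
Released under Apache 2.0 license as described in the file LICENSE.
-/
import Summits.HodgeConjecture.HodgeCM.Model.HypCensus.HypOfCensusK
import Summits.HodgeConjecture.HodgeCM.Model.HypCensus.KappaType

/-!
# Rows 18/19 at E's good canonical contexts with (V-val) DISCHARGED: `hyp12` / `hyp34` modulo the (J-T) junctions and ONE type condition

#71 (`HypOfCensusK`) proves E's binders `hyp12`/`hyp34` for the census W family from the residual families `hκ` ((V-val)) and
`homg`/`homg₃₄` ((J-T12)/(J-T34)).  #75/#76 (`KappaSlot`/`KappaType`) prove `hκ` at `η = (χ_V∘det_V)·(χ_W∘det_W)` from the single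
archimedean-type condition `HasArchType χ_V (pairType …)` in the positive `W`-reading at `v₁` with the canonical representative — and that this
IS the branch of every good context of the bit of record `orientBitι L ι₁` under E's guard `(mk ι₁).embedding = ι₁` (`hposW_of_goodCtx_orientBitι`).

This leaf composes them POINTWISE (one good context at a time — the shape in which the pin children #397/#398/#399T consume the
census, `fun {L} {ι₁} V c hc h6 hcan => …`):

* §1 (any `η` family, any bit `h`, no guard) **`hyp12_of_census_of_hκAt`** / **`hyp34_of_census_of_hκAt`**: E's binder AT `(V, c)` from the context
  datum `jD`, the (J-T) junction at `(V, c)` and the (V-val) identity **at `(V, c)` only** (`hκ : ∀ hW k, …`) — #71 made pointwise, so that ANY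
  pointwise discharge of `hκ` (this lineage's #76 `hκ_of_hasArchType_pairType`, or carch-1's R1-pin version at `χV := χVR`) plugs in;
* §2 for the W family `Wcm hGR (EtaChi.η χV χW) …` of the pin children, bit of record `orientBitι L ι₁`, guard `hcan`:
  **`hyp12_of_census_of_typeAt`**: E's binder `hyp12` AT `(V, c)` — conclusion = E's row-18 text at the bit of record read at one context,
  INCLUDING the guard `hcan` — from: the context datum `jD`, the (J-T12) junction `homg` at `(V, c)`, and **`hnV : HasArchType (χV V c) (pairType …)`**;
* **`hyp34_of_census_of_typeAt`**: the same for `hyp34` with `homg₃₄`.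

RESIDUAL LIST of rows 18/19 after this leaf (kernel-exact): { the archimedean TYPE of E's `χ_V` at each good canonical context (`pairType`:
`−pairVacExponent b` off `v₁`, `−e_P(v₁)` at `v₁`; SATISFIABLE alone — `exists_unitaryLineChar_hκ` — and to be matched with the S side's use of the
same `χ_V`), `homg`/`homg₃₄` ((J-T) `∀ φ` junctions; (T12) desk) } + data `jD`.  Nothing here is a claim of PerL/QW8.

**(T12)/(B1′) second table.** RULING S5b (B1′) re-base: the four pointwise sockets carry the torus twist `{σ}` (implicit, right after `jD`); `σ = 1` = the statements of
record, `σ = sigma34 c.D` is the (34) census of N4/N5.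
-/

set_option autoImplicit false

noncomputable section

open scoped TensorProduct InnerProductSpace Matrix Topology Classical
open Filter
open NumberField NumberField.InfinitePlace

namespace HodgeCM.Model.HypCensus

open HodgeCM HodgeCM.Model HodgeCM.Universe HodgeCM.Adelic
open HodgeCM.Universe (AdelicThetaCore AdelicThetaCore₀ SideData ThetaModel)
open HodgeCM.PerL34 HodgeCM.PerL34.ArchC HodgeCM.PerL34.Fock HodgeCM.PerL34.Fock.PrintDict
open Literature.AlgebraicGeometry.HodgeTheory
open Literature.NumberTheory.Automorphic.PicardCM
open Literature.NumberTheory.Transcendental (Arapura2012_Cor_15_4_6)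
open Literature.NumberTheory.Automorphic (piSchwartzBruhat FinSB)
open Literature.NumberTheory.Automorphic.UnitaryGroup
open Literature.NumberTheory.Weil1964 (repWeilThetaDatum)
open Literature.NumberTheory.GelbartRogawski1991 Literature.NumberTheory.GelbartRogawski1991.UnitaryDualPair
open NumberField.SeesawArchTorus

section EAny

variable (hHD : exists_isReal_hodgeModel) (hI : hodgePQ_independent_of_hodgeModel)
  (h₁ : BallQuotientUniformised)  (h₃ : CMAbelianVarietyRealised)
variable (h : Bool) (hA : Arapura2012_Cor_15_4_6)
variable
  (hGR : ∀ {L : CMField} {ι₁ : L →+* ℂ} (V : HermSpace3 L ι₁) (c : SeesawCtx L),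
    (cmSplittingDatum (L : Type) finProdFinEquiv (frameD V) (frameD_real V) (frameD_ne V) (dW c.D) (dW_real c.D) (dW_ne c.D)).CompatibleSplitting)
  (η : ∀ {L : CMField} {ι₁ : L →+* ℂ} (V : HermSpace3 L ι₁) (c : SeesawCtx L),
    CMAdelic (L : Type) (frameD V) × CMAdelic (L : Type) (dW c.D) →* ℂˣ)
  (hη : ∀ {L : CMField} {ι₁ : L →+* ℂ} (V : HermSpace3 L ι₁) (c : SeesawCtx L),
    ∀ γU ∈ CMRat (L : Type) (frameD V), ∀ γ ∈ CMRat (L : Type) (dW c.D), η V c (γU, γ) = 1)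
  (hηc : ∀ {L : CMField} {ι₁ : L →+* ℂ} (V : HermSpace3 L ι₁) (c : SeesawCtx L), Continuous fun p => ((η V c p : ℂˣ) : ℂ))
  (S : ∀ {L : CMField} {ι₁ : L →+* ℂ} (V : HermSpace3 L ι₁) (c : SeesawCtx L), ThetaAdelicSide V c)
  (μ : ∀ {L : CMField}, SeesawCtx L → Fin 4 → InfinitePlace L → ℤ)
variable {L : CMField} {ι₁ : L →+* ℂ} (V : HermSpace3 L ι₁) (c : SeesawCtx L)

/-- **E's binder `hyp12` (row 18) AT ONE GOOD CONTEXT (any bit `h`, any `η` family), modulo the (J-T) junction `homg` and the (V-val) identity `hκ` AT `(V, c)`** (#71 made pointwise; (J-dense) discharged by #70). -/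
theorem hyp12_of_census_of_hκAt
    (hc : (thetaModelOf hHD hI h₁ h₃ h (_root_.HodgeCM.Model.embOf hHD hI h₁ h₃) (coverOf hHD hI h₁ h₃ hA) (wmOfInput (Wcm hGR η hη hηc)) (thetaOf _ (thetaClassInputOf _ (fun V c => thetaSpaceInputOf hHD hI h₁ h₃ S V c))) (d12Of μ) (d34Of μ)).GoodCtx ι₁ c)
    (hK : Module.finrank ℚ c.K = 6)
    (jD : InfinitePlace (L : Type) → EqVar → Fin 6) {σ : InfinitePlace (L : Type) → Equiv.Perm (Fin 2)}
    (hκ : ∀ (hW : (∀ j, 0 < (ι₁ ((dW c.D) j)).re) ∨ ∀ j, (ι₁ ((dW c.D) j)).re < 0), ∀ k : ↥(KInfty V),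
      ((η V c (kPair V c.D ι₁ V.sylvesterFrame (sylvesterFrame_formCongr V) k) : ℂˣ) : ℂ) *
          ((pinLetterChar V c.D (hGR V c) hW (kVLetters V c.D (lett V c.D k)) : Circle) : ℂ) * dVIota V c.D (lett V c.D k (cmPlace (L : Type) ι₁)) =
        ((Literature.NumberTheory.Automorphic.UnitaryGroup.archKappa (L : Type) V.Hm ι₁ V.sylvesterFrame (sylvesterFrame_formCongr V) k : ℂˣ) : ℂ))
    (homg : ∀ (hW : (∀ j, 0 < (ι₁ ((dW c.D) j)).re) ∨ ∀ j, (ι₁ ((dW c.D) j)).re < 0) (f : FinSB ↥(maximalRealSubfield L) (Fin 6))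
      (t : (printedAtσ V c.D hW jD (fun w => -μ c 0 w) (fun w => -μ c 1 w) σ).Tg)
      (φ : (printedAtσ V c.D hW jD (fun w => -μ c 0 w) (fun w => -μ c 1 w) σ).F),
      omgW (Wcm hGR η hη hηc V c)
          (printedTorusHom (kindOf (L : Type) (frameD V) (frameD_real V) (dW c.D) (dW_real c.D) ι₁ (datumAtσ V c.D jD (jIOf V c.D hW) σ))
            (lamOf (L : Type) (frameD V) (frameD_real V) (dW c.D) (dW_real c.D) ι₁ (datumAtσ V c.D jD (jIOf V c.D hW) σ))
            (lamOf_ne_zero (L : Type) (frameD V) (frameD_real V) (dW c.D) (dW_real c.D) ι₁ (datumAtσ V c.D jD (jIOf V c.D hW) σ))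
            (c.D.jT₁₂.toMonoidHom.comp (toAdeles (L : Type)))
            (pinnedVacs (kindOf (L : Type) (frameD V) (frameD_real V) (dW c.D) (dW_real c.D) ι₁ (datumAtσ V c.D jD (jIOf V c.D hW) σ))
              (fun w => -μ c 0 w) (fun w => -μ c 1 w)) t)
          (ins (L : Type) (frameD V) (frameD_real V) (frameD_ne V) (dW c.D) (dW_real c.D) (dW_ne c.D) ι₁ (datumAtσ V c.D jD (jIOf V c.D hW) σ)
            (fun w => -μ c 0 w) (fun w => -μ c 1 w) f φ) =
        ins (L : Type) (frameD V) (frameD_real V) (frameD_ne V) (dW c.D) (dW_real c.D) (dW_ne c.D) ι₁ (datumAtσ V c.D jD (jIOf V c.D hW) σ)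
          (fun w => -μ c 0 w) (fun w => -μ c 1 w) f
          ((printedAtσ V c.D hW jD (fun w => -μ c 0 w) (fun w => -μ c 1 w) σ).ωT t φ)) :
    Nonempty (((coreOf _ (_root_.HodgeCM.Model.embOf hHD hI h₁ h₃) (coverOf hHD hI h₁ h₃ hA) (wmOfInput (Wcm hGR η hη hηc)) (thetaOf _ (thetaClassInputOf _ (fun V c => thetaSpaceInputOf hHD hI h₁ h₃ S V c)))).toCore h).HypSmoothCore12
      (((coreOf _ (_root_.HodgeCM.Model.embOf hHD hI h₁ h₃) (coverOf hHD hI h₁ h₃ hA) (wmOfInput (Wcm hGR η hη hηc)) (thetaOf _ (thetaClassInputOf _ (fun V c => thetaSpaceInputOf hHD hI h₁ h₃ S V c)))).toCore h).side12 (d12Of μ)) (((coreOf _ (_root_.HodgeCM.Model.embOf hHD hI h₁ h₃) (coverOf hHD hI h₁ h₃ hA) (wmOfInput (Wcm hGR η hη hηc)) (thetaOf _ (thetaClassInputOf _ (fun V c => thetaSpaceInputOf hHD hI h₁ h₃ S V c)))).toCore h).side34 (d34Of μ))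
      ((((coreOf _ (_root_.HodgeCM.Model.embOf hHD hI h₁ h₃) (coverOf hHD hI h₁ h₃ hA) (wmOfInput (Wcm hGR η hη hηc)) (thetaOf _ (thetaClassInputOf _ (fun V c => thetaSpaceInputOf hHD hI h₁ h₃ S V c)))).toCore h).analyticKM (((coreOf _ (_root_.HodgeCM.Model.embOf hHD hI h₁ h₃) (coverOf hHD hI h₁ h₃ hA) (wmOfInput (Wcm hGR η hη hηc)) (thetaOf _ (thetaClassInputOf _ (fun V c => thetaSpaceInputOf hHD hI h₁ h₃ S V c)))).toCore h).side12 (d12Of μ))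
        (((coreOf _ (_root_.HodgeCM.Model.embOf hHD hI h₁ h₃) (coverOf hHD hI h₁ h₃ hA) (wmOfInput (Wcm hGR η hη hηc)) (thetaOf _ (thetaClassInputOf _ (fun V c => thetaSpaceInputOf hHD hI h₁ h₃ S V c)))).toCore h).side34 (d34Of μ))).toAnalytic) V c (ℓ := linOfInput (Wcm hGR η hη hηc) V c)) := by
  have hW : (∀ j, 0 < (ι₁ ((dW c.D) j)).re) ∨ ∀ j, (ι₁ ((dW c.D) j)).re < 0 :=
    WGuard.dW_definite_of_thetaModel_goodCtx _ c (cpinC hHD hI h₁ h₃ hA (Wcm hGR η hη hηc) S) h (d12Of μ) (d34Of μ) hc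
  exact (nonempty_hypCoreW₁₂_wmInputCM₂g V c.D (hGR V c) (η V c) (hη V c) (hηc V c)
      (isAnisotropic_of_goodCtx V hc hK) hW jD (fun w => -μ c 0 w) (fun w => -μ c 1 w) (hκ hW) (homg hW)
      (hdense_of_hκ V c.D (hGR V c) (η V c) (hη V c) (hηc V c) hW jD
        (fun w => -μ c 0 w) (fun w => -μ c 1 w) (hκ hW))).elim fun A =>
    nonempty_hypSmoothCore12_of_coreW hHD hI h₁ h₃ h hA (Wcm hGR η hη hηc) S μ V c
      ((cpinC hHD hI h₁ h₃ hA (Wcm hGR η hη hηc) S).isAnisotropic_gramW_of_goodCtx h (d12Of μ) (d34Of μ) hc) A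

/-- **E's binder `hyp34` (row 19) AT ONE GOOD CONTEXT (any bit `h`, any `η` family), modulo the (J-T) junction `homg₃₄` and the (V-val) identity `hκ` AT `(V, c)`** (#71 made pointwise; (J-dense) discharged by #70). -/
theorem hyp34_of_census_of_hκAt
    (hc : (thetaModelOf hHD hI h₁ h₃ h (_root_.HodgeCM.Model.embOf hHD hI h₁ h₃) (coverOf hHD hI h₁ h₃ hA) (wmOfInput (Wcm hGR η hη hηc)) (thetaOf _ (thetaClassInputOf _ (fun V c => thetaSpaceInputOf hHD hI h₁ h₃ S V c))) (d12Of μ) (d34Of μ)).GoodCtx ι₁ c)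
    (hK : Module.finrank ℚ c.K = 6)
    (jD : InfinitePlace (L : Type) → EqVar → Fin 6) {σ : InfinitePlace (L : Type) → Equiv.Perm (Fin 2)}
    (hκ : ∀ (hW : (∀ j, 0 < (ι₁ ((dW c.D) j)).re) ∨ ∀ j, (ι₁ ((dW c.D) j)).re < 0), ∀ k : ↥(KInfty V),
      ((η V c (kPair V c.D ι₁ V.sylvesterFrame (sylvesterFrame_formCongr V) k) : ℂˣ) : ℂ) *
          ((pinLetterChar V c.D (hGR V c) hW (kVLetters V c.D (lett V c.D k)) : Circle) : ℂ) * dVIota V c.D (lett V c.D k (cmPlace (L : Type) ι₁)) =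
        ((Literature.NumberTheory.Automorphic.UnitaryGroup.archKappa (L : Type) V.Hm ι₁ V.sylvesterFrame (sylvesterFrame_formCongr V) k : ℂˣ) : ℂ))
    (homg₃₄ : ∀ (hW : (∀ j, 0 < (ι₁ ((dW c.D) j)).re) ∨ ∀ j, (ι₁ ((dW c.D) j)).re < 0) (f : FinSB ↥(maximalRealSubfield L) (Fin 6))
      (t : (printedAtσ V c.D hW jD (fun w => -μ c 2 w) (fun w => -μ c 3 w) σ).Tg)
      (φ : (printedAtσ V c.D hW jD (fun w => -μ c 2 w) (fun w => -μ c 3 w) σ).F),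
      omgW (Wcm hGR η hη hηc V c)
          (printedTorusHom (kindOf (L : Type) (frameD V) (frameD_real V) (dW c.D) (dW_real c.D) ι₁ (datumAtσ V c.D jD (jIOf V c.D hW) σ))
            (lamOf (L : Type) (frameD V) (frameD_real V) (dW c.D) (dW_real c.D) ι₁ (datumAtσ V c.D jD (jIOf V c.D hW) σ))
            (lamOf_ne_zero (L : Type) (frameD V) (frameD_real V) (dW c.D) (dW_real c.D) ι₁ (datumAtσ V c.D jD (jIOf V c.D hW) σ))
            (c.D.jT₃₄.toMonoidHom.comp (toAdeles (L : Type)))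
            (pinnedVacs (kindOf (L : Type) (frameD V) (frameD_real V) (dW c.D) (dW_real c.D) ι₁ (datumAtσ V c.D jD (jIOf V c.D hW) σ))
              (fun w => -μ c 2 w) (fun w => -μ c 3 w)) t)
          (ins₃₄ V c.D (hGR V c) (η V c) (datumAtσ V c.D jD (jIOf V c.D hW) σ) (fun w => -μ c 2 w) (fun w => -μ c 3 w) f φ) =
        ins₃₄ V c.D (hGR V c) (η V c) (datumAtσ V c.D jD (jIOf V c.D hW) σ) (fun w => -μ c 2 w) (fun w => -μ c 3 w) f
          ((printedAtσ V c.D hW jD (fun w => -μ c 2 w) (fun w => -μ c 3 w) σ).ωT t φ)) :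
    Nonempty (((coreOf _ (_root_.HodgeCM.Model.embOf hHD hI h₁ h₃) (coverOf hHD hI h₁ h₃ hA) (wmOfInput (Wcm hGR η hη hηc)) (thetaOf _ (thetaClassInputOf _ (fun V c => thetaSpaceInputOf hHD hI h₁ h₃ S V c)))).toCore h).HypSmoothCore34
      (((coreOf _ (_root_.HodgeCM.Model.embOf hHD hI h₁ h₃) (coverOf hHD hI h₁ h₃ hA) (wmOfInput (Wcm hGR η hη hηc)) (thetaOf _ (thetaClassInputOf _ (fun V c => thetaSpaceInputOf hHD hI h₁ h₃ S V c)))).toCore h).side12 (d12Of μ)) (((coreOf _ (_root_.HodgeCM.Model.embOf hHD hI h₁ h₃) (coverOf hHD hI h₁ h₃ hA) (wmOfInput (Wcm hGR η hη hηc)) (thetaOf _ (thetaClassInputOf _ (fun V c => thetaSpaceInputOf hHD hI h₁ h₃ S V c)))).toCore h).side34 (d34Of μ))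
      ((((coreOf _ (_root_.HodgeCM.Model.embOf hHD hI h₁ h₃) (coverOf hHD hI h₁ h₃ hA) (wmOfInput (Wcm hGR η hη hηc)) (thetaOf _ (thetaClassInputOf _ (fun V c => thetaSpaceInputOf hHD hI h₁ h₃ S V c)))).toCore h).analyticKM (((coreOf _ (_root_.HodgeCM.Model.embOf hHD hI h₁ h₃) (coverOf hHD hI h₁ h₃ hA) (wmOfInput (Wcm hGR η hη hηc)) (thetaOf _ (thetaClassInputOf _ (fun V c => thetaSpaceInputOf hHD hI h₁ h₃ S V c)))).toCore h).side12 (d12Of μ))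
        (((coreOf _ (_root_.HodgeCM.Model.embOf hHD hI h₁ h₃) (coverOf hHD hI h₁ h₃ hA) (wmOfInput (Wcm hGR η hη hηc)) (thetaOf _ (thetaClassInputOf _ (fun V c => thetaSpaceInputOf hHD hI h₁ h₃ S V c)))).toCore h).side34 (d34Of μ))).toAnalytic) V c (ℓ := linOfInput (Wcm hGR η hη hηc) V c)) := by
  have hW : (∀ j, 0 < (ι₁ ((dW c.D) j)).re) ∨ ∀ j, (ι₁ ((dW c.D) j)).re < 0 :=
    WGuard.dW_definite_of_thetaModel_goodCtx _ c (cpinC hHD hI h₁ h₃ hA (Wcm hGR η hη hηc) S) h (d12Of μ) (d34Of μ) hc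
  exact (nonempty_hypCoreW₃₄_wmInputCM₂g V c.D (hGR V c) (η V c) (hη V c) (hηc V c)
      (isAnisotropic_of_goodCtx V hc hK) hW jD (fun w => -μ c 2 w) (fun w => -μ c 3 w) (hκ hW) (homg₃₄ hW)
      (hdense_of_hκ V c.D (hGR V c) (η V c) (hη V c) (hηc V c) hW jD
        (fun w => -μ c 2 w) (fun w => -μ c 3 w) (hκ hW))).elim fun A =>
    nonempty_hypSmoothCore34_of_coreW hHD hI h₁ h₃ h hA (Wcm hGR η hη hηc) S μ V c
      ((cpinC hHD hI h₁ h₃ hA (Wcm hGR η hη hηc) S).isAnisotropic_gramW_of_goodCtx h (d12Of μ) (d34Of μ) hc) A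

end EAny

section E

variable (hHD : exists_isReal_hodgeModel) (hI : hodgePQ_independent_of_hodgeModel)
  (h₁ : BallQuotientUniformised)  (h₃ : CMAbelianVarietyRealised)
variable (hA : Arapura2012_Cor_15_4_6)
variable
  (hGR : ∀ {L : CMField} {ι₁ : L →+* ℂ} (V : HermSpace3 L ι₁) (c : SeesawCtx L),
    (cmSplittingDatum (L : Type) finProdFinEquiv (frameD V) (frameD_real V) (frameD_ne V) (dW c.D) (dW_real c.D) (dW_ne c.D)).CompatibleSplitting)
  (χV χW : ∀ {L : CMField} {ι₁ : L →+* ℂ} (_V : HermSpace3 L ι₁) (_c : SeesawCtx L),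
    ContinuousMonoidHom (Literature.NumberTheory.Automorphic.relNormOneIdeles (maximalRealSubfield (L : Type)) (L : Type) ⧸
      Literature.NumberTheory.Automorphic.relNormOneRat (maximalRealSubfield (L : Type)) (L : Type)) Circle)
  (S : ∀ {L : CMField} {ι₁ : L →+* ℂ} (V : HermSpace3 L ι₁) (c : SeesawCtx L), ThetaAdelicSide V c)
  (μ : ∀ {L : CMField}, SeesawCtx L → Fin 4 → InfinitePlace L → ℤ)
variable {L : CMField} {ι₁ : L →+* ℂ} (V : HermSpace3 L ι₁) (c : SeesawCtx L)

/-- **E's binder `hyp12` (row 18) AT ONE GOOD CANONICAL CONTEXT of the bit of record, for the W family of the pin children,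
modulo the (J-T) junction `homg` and ONE archimedean-type condition on `χ_V V c`** ((V-val) and (J-dense) discharged: #70, #75, #76). -/
theorem hyp12_of_census_of_typeAt
    (hc : (thetaModelOf hHD hI h₁ h₃ (orientBitι L ι₁) (_root_.HodgeCM.Model.embOf hHD hI h₁ h₃) (coverOf hHD hI h₁ h₃ hA) (wmOfInput (Wcm hGR (EtaChi.η @χV @χW) (EtaChi.hη @χV @χW) (EtaChi.hηc @χV @χW))) (thetaOf _ (thetaClassInputOf _ (fun V c => thetaSpaceInputOf hHD hI h₁ h₃ S V c))) (d12Of μ) (d34Of μ)).GoodCtx ι₁ c)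
    (hK : Module.finrank ℚ c.K = 6) (hcan : (InfinitePlace.mk ι₁).embedding = ι₁)
    (jD : InfinitePlace (L : Type) → EqVar → Fin 6) {σ : InfinitePlace (L : Type) → Equiv.Perm (Fin 2)}
    (hnV : ∀ (hW : (∀ j, 0 < (ι₁ ((dW c.D) j)).re) ∨ ∀ j, (ι₁ ((dW c.D) j)).re < 0)
      (hpos : ∀ j, 0 < cmXW (L : Type) (frameD V) (dW c.D) (dW_real c.D) ι₁ (cmPlace (L : Type) ι₁) j),
      Literature.NumberTheory.Automorphic.UnitaryLineChar.HasArchType (L : Type) (χV V c) (pairType V c.D (hGR V c) hW hpos))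
    (homg : ∀ (hW : (∀ j, 0 < (ι₁ ((dW c.D) j)).re) ∨ ∀ j, (ι₁ ((dW c.D) j)).re < 0) (f : FinSB ↥(maximalRealSubfield L) (Fin 6))
      (t : (printedAtσ V c.D hW jD (fun w => -μ c 0 w) (fun w => -μ c 1 w) σ).Tg)
      (φ : (printedAtσ V c.D hW jD (fun w => -μ c 0 w) (fun w => -μ c 1 w) σ).F),
      omgW (Wcm hGR (EtaChi.η @χV @χW) (EtaChi.hη @χV @χW) (EtaChi.hηc @χV @χW) V c)
          (printedTorusHom (kindOf (L : Type) (frameD V) (frameD_real V) (dW c.D) (dW_real c.D) ι₁ (datumAtσ V c.D jD (jIOf V c.D hW) σ))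
            (lamOf (L : Type) (frameD V) (frameD_real V) (dW c.D) (dW_real c.D) ι₁ (datumAtσ V c.D jD (jIOf V c.D hW) σ))
            (lamOf_ne_zero (L : Type) (frameD V) (frameD_real V) (dW c.D) (dW_real c.D) ι₁ (datumAtσ V c.D jD (jIOf V c.D hW) σ))
            (c.D.jT₁₂.toMonoidHom.comp (toAdeles (L : Type)))
            (pinnedVacs (kindOf (L : Type) (frameD V) (frameD_real V) (dW c.D) (dW_real c.D) ι₁ (datumAtσ V c.D jD (jIOf V c.D hW) σ))
              (fun w => -μ c 0 w) (fun w => -μ c 1 w)) t)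
          (ins (L : Type) (frameD V) (frameD_real V) (frameD_ne V) (dW c.D) (dW_real c.D) (dW_ne c.D) ι₁ (datumAtσ V c.D jD (jIOf V c.D hW) σ)
            (fun w => -μ c 0 w) (fun w => -μ c 1 w) f φ) =
        ins (L : Type) (frameD V) (frameD_real V) (frameD_ne V) (dW c.D) (dW_real c.D) (dW_ne c.D) ι₁ (datumAtσ V c.D jD (jIOf V c.D hW) σ)
          (fun w => -μ c 0 w) (fun w => -μ c 1 w) f
          ((printedAtσ V c.D hW jD (fun w => -μ c 0 w) (fun w => -μ c 1 w) σ).ωT t φ)) :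
    Nonempty (((coreOf _ (_root_.HodgeCM.Model.embOf hHD hI h₁ h₃) (coverOf hHD hI h₁ h₃ hA) (wmOfInput (Wcm hGR (EtaChi.η @χV @χW) (EtaChi.hη @χV @χW) (EtaChi.hηc @χV @χW))) (thetaOf _ (thetaClassInputOf _ (fun V c => thetaSpaceInputOf hHD hI h₁ h₃ S V c)))).toCore (orientBitι L ι₁)).HypSmoothCore12
      (((coreOf _ (_root_.HodgeCM.Model.embOf hHD hI h₁ h₃) (coverOf hHD hI h₁ h₃ hA) (wmOfInput (Wcm hGR (EtaChi.η @χV @χW) (EtaChi.hη @χV @χW) (EtaChi.hηc @χV @χW))) (thetaOf _ (thetaClassInputOf _ (fun V c => thetaSpaceInputOf hHD hI h₁ h₃ S V c)))).toCore (orientBitι L ι₁)).side12 (d12Of μ)) (((coreOf _ (_root_.HodgeCM.Model.embOf hHD hI h₁ h₃) (coverOf hHD hI h₁ h₃ hA) (wmOfInput (Wcm hGR (EtaChi.η @χV @χW) (EtaChi.hη @χV @χW) (EtaChi.hηc @χV @χW))) (thetaOf _ (thetaClassInputOf _ (fun V c => thetaSpaceInputOf hHD hI h₁ h₃ S V c)))).toCore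 (orientBitι L ι₁)).side34 (d34Of μ))
      ((((coreOf _ (_root_.HodgeCM.Model.embOf hHD hI h₁ h₃) (coverOf hHD hI h₁ h₃ hA) (wmOfInput (Wcm hGR (EtaChi.η @χV @χW) (EtaChi.hη @χV @χW) (EtaChi.hηc @χV @χW))) (thetaOf _ (thetaClassInputOf _ (fun V c => thetaSpaceInputOf hHD hI h₁ h₃ S V c)))).toCore (orientBitι L ι₁)).analyticKM (((coreOf _ (_root_.HodgeCM.Model.embOf hHD hI h₁ h₃) (coverOf hHD hI h₁ h₃ hA) (wmOfInput (Wcm hGR (EtaChi.η @χV @χW) (EtaChi.hη @χV @χW) (EtaChi.hηc @χV @χW))) (thetaOf _ (thetaClassInputOf _ (fun V c => thetaSpaceInputOf hHD hI h₁ h₃ S V c)))).toCore (orientBitι L ι₁)).side12 (d12Of μ))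
        (((coreOf _ (_root_.HodgeCM.Model.embOf hHD hI h₁ h₃) (coverOf hHD hI h₁ h₃ hA) (wmOfInput (Wcm hGR (EtaChi.η @χV @χW) (EtaChi.hη @χV @χW) (EtaChi.hηc @χV @χW))) (thetaOf _ (thetaClassInputOf _ (fun V c => thetaSpaceInputOf hHD hI h₁ h₃ S V c)))).toCore (orientBitι L ι₁)).side34 (d34Of μ))).toAnalytic) V c (ℓ := linOfInput (Wcm hGR (EtaChi.η @χV @χW) (EtaChi.hη @χV @χW) (EtaChi.hηc @χV @χW)) V c)) := by
  have hc' : SignRecipe.GoodCtx (orientBitι L ι₁) ι₁ c :=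
    ((cpinC hHD hI h₁ h₃ hA (Wcm hGR (EtaChi.η @χV @χW) (EtaChi.hη @χV @χW) (EtaChi.hηc @χV @χW)) S).thetaModel_goodCtx_iff
      (orientBitι L ι₁) (d12Of μ) (d34Of μ) ι₁ c).mp hc
  exact hyp12_of_census_of_hκAt hHD hI h₁ h₃ (orientBitι L ι₁) hA hGR (EtaChi.η @χV @χW) (EtaChi.hη @χV @χW) (EtaChi.hηc @χV @χW) S μ V c
    hc hK jD (fun hW => hκ_of_hasArchType_pairType V c.D (hGR V c) hW (χV V c) (χW V c) (hposW_of_goodCtx_orientBitι V hc' hcan) hcan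
      (hnV hW (hposW_of_goodCtx_orientBitι V hc' hcan))) homg

/-- **E's binder `hyp34` (row 19) AT ONE GOOD CANONICAL CONTEXT of the bit of record, for the W family of the pin children,
modulo the (J-T) junction `homg₃₄` and ONE archimedean-type condition on `χ_V V c`** ((V-val) and (J-dense) discharged: #70, #75, #76). -/
theorem hyp34_of_census_of_typeAt
    (hc : (thetaModelOf hHD hI h₁ h₃ (orientBitι L ι₁) (_root_.HodgeCM.Model.embOf hHD hI h₁ h₃) (coverOf hHD hI h₁ h₃ hA) (wmOfInput (Wcm hGR (EtaChi.η @χV @χW) (EtaChi.hη @χV @χW) (EtaChi.hηc @χV @χW))) (thetaOf _ (thetaClassInputOf _ (fun V c => thetaSpaceInputOf hHD hI h₁ h₃ S V c))) (d12Of μ) (d34Of μ)).GoodCtx ι₁ c)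
    (hK : Module.finrank ℚ c.K = 6) (hcan : (InfinitePlace.mk ι₁).embedding = ι₁)
    (jD : InfinitePlace (L : Type) → EqVar → Fin 6) {σ : InfinitePlace (L : Type) → Equiv.Perm (Fin 2)}
    (hnV : ∀ (hW : (∀ j, 0 < (ι₁ ((dW c.D) j)).re) ∨ ∀ j, (ι₁ ((dW c.D) j)).re < 0)
      (hpos : ∀ j, 0 < cmXW (L : Type) (frameD V) (dW c.D) (dW_real c.D) ι₁ (cmPlace (L : Type) ι₁) j),
      Literature.NumberTheory.Automorphic.UnitaryLineChar.HasArchType (L : Type) (χV V c) (pairType V c.D (hGR V c) hW hpos))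
    (homg₃₄ : ∀ (hW : (∀ j, 0 < (ι₁ ((dW c.D) j)).re) ∨ ∀ j, (ι₁ ((dW c.D) j)).re < 0) (f : FinSB ↥(maximalRealSubfield L) (Fin 6))
      (t : (printedAtσ V c.D hW jD (fun w => -μ c 2 w) (fun w => -μ c 3 w) σ).Tg)
      (φ : (printedAtσ V c.D hW jD (fun w => -μ c 2 w) (fun w => -μ c 3 w) σ).F),
      omgW (Wcm hGR (EtaChi.η @χV @χW) (EtaChi.hη @χV @χW) (EtaChi.hηc @χV @χW) V c)
          (printedTorusHom (kindOf (L : Type) (frameD V) (frameD_real V) (dW c.D) (dW_real c.D) ι₁ (datumAtσ V c.D jD (jIOf V c.D hW) σ))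
            (lamOf (L : Type) (frameD V) (frameD_real V) (dW c.D) (dW_real c.D) ι₁ (datumAtσ V c.D jD (jIOf V c.D hW) σ))
            (lamOf_ne_zero (L : Type) (frameD V) (frameD_real V) (dW c.D) (dW_real c.D) ι₁ (datumAtσ V c.D jD (jIOf V c.D hW) σ))
            (c.D.jT₃₄.toMonoidHom.comp (toAdeles (L : Type)))
            (pinnedVacs (kindOf (L : Type) (frameD V) (frameD_real V) (dW c.D) (dW_real c.D) ι₁ (datumAtσ V c.D jD (jIOf V c.D hW) σ))
              (fun w => -μ c 2 w) (fun w => -μ c 3 w)) t)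
          (ins₃₄ V c.D (hGR V c) (EtaChi.η @χV @χW V c) (datumAtσ V c.D jD (jIOf V c.D hW) σ) (fun w => -μ c 2 w) (fun w => -μ c 3 w) f φ) =
        ins₃₄ V c.D (hGR V c) (EtaChi.η @χV @χW V c) (datumAtσ V c.D jD (jIOf V c.D hW) σ) (fun w => -μ c 2 w) (fun w => -μ c 3 w) f
          ((printedAtσ V c.D hW jD (fun w => -μ c 2 w) (fun w => -μ c 3 w) σ).ωT t φ)) :
    Nonempty (((coreOf _ (_root_.HodgeCM.Model.embOf hHD hI h₁ h₃) (coverOf hHD hI h₁ h₃ hA) (wmOfInput (Wcm hGR (EtaChi.η @χV @χW) (EtaChi.hη @χV @χW) (EtaChi.hηc @χV @χW))) (thetaOf _ (thetaClassInputOf _ (fun V c => thetaSpaceInputOf hHD hI h₁ h₃ S V c)))).toCore (orientBitι L ι₁)).HypSmoothCore34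
      (((coreOf _ (_root_.HodgeCM.Model.embOf hHD hI h₁ h₃) (coverOf hHD hI h₁ h₃ hA) (wmOfInput (Wcm hGR (EtaChi.η @χV @χW) (EtaChi.hη @χV @χW) (EtaChi.hηc @χV @χW))) (thetaOf _ (thetaClassInputOf _ (fun V c => thetaSpaceInputOf hHD hI h₁ h₃ S V c)))).toCore (orientBitι L ι₁)).side12 (d12Of μ)) (((coreOf _ (_root_.HodgeCM.Model.embOf hHD hI h₁ h₃) (coverOf hHD hI h₁ h₃ hA) (wmOfInput (Wcm hGR (EtaChi.η @χV @χW) (EtaChi.hη @χV @χW) (EtaChi.hηc @χV @χW))) (thetaOf _ (thetaClassInputOf _ (fun V c => thetaSpaceInputOf hHD hI h₁ h₃ S V c)))).toCore (orientBitι L ι₁)).side34 (d34Of μ))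
      ((((coreOf _ (_root_.HodgeCM.Model.embOf hHD hI h₁ h₃) (coverOf hHD hI h₁ h₃ hA) (wmOfInput (Wcm hGR (EtaChi.η @χV @χW) (EtaChi.hη @χV @χW) (EtaChi.hηc @χV @χW))) (thetaOf _ (thetaClassInputOf _ (fun V c => thetaSpaceInputOf hHD hI h₁ h₃ S V c)))).toCore (orientBitι L ι₁)).analyticKM (((coreOf _ (_root_.HodgeCM.Model.embOf hHD hI h₁ h₃) (coverOf hHD hI h₁ h₃ hA) (wmOfInput (Wcm hGR (EtaChi.η @χV @χW) (EtaChi.hη @χV @χW) (EtaChi.hηc @χV @χW))) (thetaOf _ (thetaClassInputOf _ (fun V c => thetaSpaceInputOf hHD hI h₁ h₃ S V c)))).toCore (orientBitι L ι₁)).side12 (d12Of μ))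
        (((coreOf _ (_root_.HodgeCM.Model.embOf hHD hI h₁ h₃) (coverOf hHD hI h₁ h₃ hA) (wmOfInput (Wcm hGR (EtaChi.η @χV @χW) (EtaChi.hη @χV @χW) (EtaChi.hηc @χV @χW))) (thetaOf _ (thetaClassInputOf _ (fun V c => thetaSpaceInputOf hHD hI h₁ h₃ S V c)))).toCore (orientBitι L ι₁)).side34 (d34Of μ))).toAnalytic) V c (ℓ := linOfInput (Wcm hGR (EtaChi.η @χV @χW) (EtaChi.hη @χV @χW) (EtaChi.hηc @χV @χW)) V c)) := by
  have hc' : SignRecipe.GoodCtx (orientBitι L ι₁) ι₁ c :=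
    ((cpinC hHD hI h₁ h₃ hA (Wcm hGR (EtaChi.η @χV @χW) (EtaChi.hη @χV @χW) (EtaChi.hηc @χV @χW)) S).thetaModel_goodCtx_iff
      (orientBitι L ι₁) (d12Of μ) (d34Of μ) ι₁ c).mp hc
  exact hyp34_of_census_of_hκAt hHD hI h₁ h₃ (orientBitι L ι₁) hA hGR (EtaChi.η @χV @χW) (EtaChi.hη @χV @χW) (EtaChi.hηc @χV @χW) S μ V c
    hc hK jD (fun hW => hκ_of_hasArchType_pairType V c.D (hGR V c) hW (χV V c) (χW V c) (hposW_of_goodCtx_orientBitι V hc' hcan) hcan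
      (hnV hW (hposW_of_goodCtx_orientBitι V hc' hcan))) homg₃₄

end E

end HodgeCM.Model.HypCensus

end
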